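import Literature.Geometry.Teichmuller.CayleyMaps
import Mathlib.GroupTheory.Perm.Closure
import Mathlib.GroupTheory.Perm.Cycle.Type
import Mathlib.GroupTheory.Perm.Fin
import Mathlib.Tactic.IntervalCases
import HarnessLib

/-!
# Bring's surface: the regular maps of types `{5,4}` and `{4,5}` with rotation group `S₅`

Bring's curve (Klein 1877) is the genus-4 Riemann surface `Σ : ∑ zᵢ = ∑ zᵢ² = ∑ zᵢ³ = 0` in
`ℙ⁴`, conformally Kepler's small stellated dodecahedron `{5/2, 5}` read as a branched surface
(Weber 2005, §1, §4: `V - E + F = 12 - 30 + 12 = -6`, genus 4); `Aut Σ = S₅` (Weber 2005,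
Prop. 2.2). Weber (2005, §2, p. 171) exhibits a *platonic* (regular) tessellation of `Σ` by
**24 right-angled regular hyperbolic pentagons**, four at each vertex: a regular map of type
`{5,4}` with `24` faces, `60` edges, `30` vertices, whose orientation-preserving automorphism
group is `Aut Σ = S₅` of order `120 = #darts`. Its dual is the regular map of type `{4,5}` —
**30 squares, five at each of 24 vertices** — entry **R4.2** (genus 4, type `{4,5}_6`,
`|Aut| = 240`, reflexible) of Conder's census of orientable regular maps (Conder–Dobcsányi 2001;
list "Regular orientable maps of genus 2 to 101" at `www.math.auckland.ac.nz/~conder/`, with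
defining relations `[T², R⁴, (RS)², (RT)², (ST)², S⁻⁵, (RS⁻²RS⁻¹)²]`).

## What is formalized (all proved)

By `CayleyMaps` (`Fatgraph.ofGroup`), an orientably regular map with rotation group `S₅` of type
`{5,4}` is `𝓜(S₅; s, t)` for a generating pair with `o(s) = 4`, `o(t) = 2`, `o(ts) = 5`; we take
`s = (0 1 2 3)`, `t = (3 4)`, `ts = (0 1 2 4 3)` (any such pair is conjugate to this one, so the
map is unique; not proved here).
* `pentagonMap = 𝓜(S₅; s, t)`: type `{5,4}` (`IsOfMapType 5 4`), `24` faces, `30` vertices, `60`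
  edges, connected, `χ = 30 - 60 + 24 = 2 - 2·4` (genus 4, `IsOfType 4 24`), orientably regular,
  `Aut⁺ ≃* S₅` (`pentagonMapAutEquiv`), `#Aut⁺ = 120`, reflexible (`pentagonMap_reflexible`);
* `squareMap = pentagonMap.dual = 𝓜(S₅; ts, t)`: type `{4,5}`, `30` square faces, `24` vertices
  of valency `5`, `60` edges, genus 4, regular with the same automorphism group; it is a genuine
  square complex: no loops, no two edges with the same ends (`squareMap_simpleEdges`), every
  square has four distinct corners (`squareMap_face_corners_distinct`);
* `conder_R4_2_relations`: `s`, `(ts)⁻¹` satisfy the defining relations of the rotation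
  subgroup `⟨R, S⟩` of R4.2.

## Not formalized (citations only)

That the `(2,4,5)`-triangle surface uniformising this map is Bring's curve / the small stellated
dodecahedron and that the pentagons are right-angled (Weber 2005, §§2–4), and the uniqueness
behind the label R4.2. `-- TODO(general form): regular maps as quotients of triangle groups.`
-/

noncomputable section

open Equiv Equiv.Perm Function

namespace Literature.Geometry.Teichmuller

namespace Bring

/-! ### The generating pair of `S₅` -/

/-- The vertex-rotation generator `s = (0 1 2 3)`, a 4-cycle in `S₅` (`4` fixed). [folklore] -/
def rotGen : Perm (Fin 5) :=
  ⟨![1, 2, 3, 0, 4], ![3, 0, 1, 2, 4], by decide, by decide⟩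

/-- The edge-involution generator `t = (3 4)`, a transposition. [folklore] -/
def invGen : Perm (Fin 5) := swap 3 4

/-- `t² = 1`. [folklore] -/
theorem invGen_mul_self : invGen * invGen = 1 := swap_mul_self 3 4

/-- `t ≠ 1`. [folklore] -/
theorem invGen_ne_one : invGen ≠ 1 := by decide

/-- `o(s) = 4`. [folklore] -/
theorem orderOf_rotGen : orderOf rotGen = 4 := by
  have h := orderOf_eq_prime_pow (p := 2) (n := 1) (x := rotGen) (by decide) (by decide)
  simpa using h

/-- `ts = (0 1 2 4 3)` has order `5`. [folklore] -/
theorem orderOf_invGen_mul_rotGen : orderOf (invGen * rotGen) = 5 := by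
  haveI : Fact (Nat.Prime 5) := ⟨Nat.prime_five⟩
  exact orderOf_eq_prime (by decide) (by decide)

/-- `|S₅| = 120`. [folklore] -/
theorem natCard_S5 : Nat.card (Perm (Fin 5)) = 120 := by
  rw [Nat.card_eq_fintype_card, Fintype.card_perm, Fintype.card_fin]; rfl

/-- **`ts` and `t` generate `S₅`** (a `5`-cycle and a transposition, `5` prime). [folklore] -/
theorem closure_faceGen_invGen :
    Subgroup.closure ({invGen * rotGen, invGen} : Set (Perm (Fin 5))) = ⊤ := by
  have h5 : (Fintype.card (Fin 5)).Prime := by rw [Fintype.card_fin]; exact Nat.prime_five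
  refine closure_prime_cycle_swap h5 ?_ (by decide) ⟨3, 4, by decide, rfl⟩
  exact isCycle_of_prime_order'' h5 (by rw [orderOf_invGen_mul_rotGen, Fintype.card_fin])

/-- **`s` and `t` generate `S₅`.** [folklore] -/
theorem closure_rotGen_invGen :
    Subgroup.closure ({rotGen, invGen} : Set (Perm (Fin 5))) = ⊤ := by
  rw [eq_top_iff, ← closure_faceGen_invGen, Subgroup.closure_le]
  rintro x hx
  simp only [Set.mem_insert_iff, Set.mem_singleton_iff] at hx
  rcases hx with rfl | rfl
  · exact Subgroup.mul_mem _ (Subgroup.subset_closure (by simp))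
      (Subgroup.subset_closure (by simp))
  · exact Subgroup.subset_closure (by simp)

/-- The generators satisfy the defining relations of the rotation subgroup `⟨R, S⟩` of the map
**R4.2** of Conder's census (full group `[T², R⁴, (RS)², (RT)², (ST)², S⁻⁵, (RS⁻²RS⁻¹)²]`,
`|Aut| = 240`) under `R ↦ s` (rotation about a face of the `{4,5}` map), `S ↦ (ts)⁻¹` (rotation
about a vertex, Conder's orientation): `R⁴ = S⁵ = (RS)² = (RS⁻²RS⁻¹)² = 1`.
[cite: ConderDobcsanyi2001, census of orientable regular maps, entry R4.2 (genus 4, {4,5}_6)] -/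
theorem conder_R4_2_relations :
    rotGen ^ 4 = 1 ∧ ((invGen * rotGen)⁻¹) ^ 5 = 1 ∧ (rotGen * (invGen * rotGen)⁻¹) ^ 2 = 1 ∧
      (rotGen * (invGen * rotGen) ^ 2 * rotGen * (invGen * rotGen)) ^ 2 = 1 := by
  decide

/-- Elements of `⟨ts⟩` are the powers `(ts)^j`, `j < 5`: a permutation avoided by these five is
not in `⟨ts⟩`. [folklore] -/
theorem notMem_zpowers_faceGen {x : Perm (Fin 5)} (h : ∀ j : ℕ, j < 5 → (invGen * rotGen) ^ j ≠ x) :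
    x ∉ Subgroup.zpowers (invGen * rotGen) := by
  intro hx
  rw [Subgroup.mem_zpowers_iff] at hx
  obtain ⟨k, hk⟩ := hx
  rw [← zpow_mod_orderOf, orderOf_invGen_mul_rotGen] at hk
  obtain ⟨n, hn⟩ := Int.eq_ofNat_of_zero_le (Int.emod_nonneg k (by norm_num : ((5 : ℕ) : ℤ) ≠ 0))
  have hlt := Int.emod_lt_of_pos k (by norm_num : (0 : ℤ) < ((5 : ℕ) : ℤ))
  rw [hn, zpow_natCast] at hk
  exact h n (by omega) hk

/-! ### The `{5,4}` map: 24 pentagons, four at each of 30 vertices -/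

/-- **The regular map of type `{5,4}` on Bring's surface** (Weber's platonic tessellation by 24
right-angled pentagons), as `𝓜(S₅; s, t)`: darts `= S₅`, vertex rotation `(· * s)`, edge
involution `(· * t)`, face permutation `(· * ts)`.
[cite: Weber2005, §2 (p. 171: tessellation by 24 right-angled pentagons) and Prop. 2.2] -/
def pentagonMap : Fatgraph (Perm (Fin 5)) :=
  Fatgraph.ofGroup rotGen invGen invGen_mul_self invGen_ne_one

/-- Type `{5,4}`: every face is a pentagon, every vertex is 4-valent.
[cite: Weber2005, §2 (p. 171)] -/
theorem pentagonMap_isOfMapType : pentagonMap.IsOfMapType 5 4 := by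
  have h := Fatgraph.ofGroup_isOfMapType rotGen invGen invGen_mul_self invGen_ne_one
  rw [orderOf_invGen_mul_rotGen, orderOf_rotGen] at h
  unfold pentagonMap
  exact h

/-- `24` pentagonal faces. [cite: Weber2005, §2 (p. 171)] -/
theorem pentagonMap_numBoundary : pentagonMap.numBoundary = 24 := by
  unfold pentagonMap
  exact Fatgraph.ofGroup_numBoundary_eq (G := Perm (Fin 5)) rotGen invGen invGen_mul_self
    invGen_ne_one (by rw [natCard_S5, orderOf_invGen_mul_rotGen])

/-- `30` vertices. [folklore] -/
theorem pentagonMap_numVertices : pentagonMap.numVertices = 30 := by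
  unfold pentagonMap
  exact Fatgraph.ofGroup_numVertices_eq (G := Perm (Fin 5)) rotGen invGen invGen_mul_self
    invGen_ne_one (by rw [natCard_S5, orderOf_rotGen])

/-- `60` edges. [folklore] -/
theorem pentagonMap_numEdges : pentagonMap.numEdges = 60 := by
  unfold pentagonMap
  exact Fatgraph.ofGroup_numEdges_eq (G := Perm (Fin 5)) rotGen invGen invGen_mul_self
    invGen_ne_one (by rw [natCard_S5])

/-- The map is connected. [folklore] -/
theorem pentagonMap_isConnected : pentagonMap.IsConnected := by
  unfold pentagonMap
  exact Fatgraph.ofGroup_isConnected _ _ _ _ closure_rotGen_invGen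

/-- **Euler characteristic `30 - 60 + 24 = -6 = 2 - 2·4`.**
[cite: Weber2005, §1 (V − E + F = −6, genus 4)] -/
theorem pentagonMap_eulerChar : pentagonMap.eulerChar = 2 - 2 * 4 := by
  rw [Fatgraph.eulerChar, pentagonMap_numVertices, pentagonMap_numEdges, pentagonMap_numBoundary]
  norm_num

/-- **Genus 4**: the closed surface of the map (the 24 faces capped) is the connected closed
oriented surface of genus `4` (`IsOfType 4 24`: connected, `24` faces, `V - E = 2 - 2·4 - 24`).
[cite: Weber2005, §1–§2] -/
theorem pentagonMap_isOfType : pentagonMap.IsOfType 4 24 := by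
  rw [Fatgraph.isOfType_iff_eulerChar]
  exact ⟨pentagonMap_isConnected, pentagonMap_numBoundary, by rw [pentagonMap_eulerChar]; norm_num⟩

/-- The map is orientably regular (`Aut⁺` is transitive on the `120` darts).
[cite: Weber2005, §2 (platonic tessellation)] -/
theorem pentagonMap_isOrientablyRegular : pentagonMap.IsOrientablyRegular := by
  unfold pentagonMap
  exact Fatgraph.ofGroup_isOrientablyRegular _ _ _ _

/-- `Aut⁺` of the `{5,4}` map = the left translations of `S₅`. [folklore] -/
theorem pentagonMap_automorphismGroup :
    pentagonMap.automorphismGroup = (Fatgraph.leftRegularHom (Perm (Fin 5))).range := by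
  unfold pentagonMap
  exact Fatgraph.ofGroup_automorphismGroup _ _ _ _ closure_rotGen_invGen

/-- **The rotation group is `S₅`**: `S₅ ≃* Aut⁺(pentagonMap)`, `g ↦ (g * ·)`.
[cite: Weber2005, Prop. 2.2 (Aut Σ = S₅)] -/
def pentagonMapAutEquiv : Perm (Fin 5) ≃* pentagonMap.automorphismGroup :=
  Fatgraph.ofGroupAutEquiv rotGen invGen invGen_mul_self invGen_ne_one closure_rotGen_invGen

/-- `#Aut⁺ = 120`. [cite: Weber2005, Prop. 2.2] -/
theorem pentagonMap_numAut : pentagonMap.numAut = 120 := by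
  unfold pentagonMap
  rw [Fatgraph.ofGroup_numAut rotGen invGen invGen_mul_self invGen_ne_one closure_rotGen_invGen,
    natCard_S5]

/-- **Reflexibility**: the dart map `g ↦ c g c`, `c = (0 2)` (`c s c = s⁻¹`, `c t c = t`), is an
orientation-reversing automorphism: it conjugates the vertex rotation to its inverse and commutes
with the edge involution, i.e. the map is isomorphic to its mirror image (census: R4.2 is
reflexible, `|Aut| = 240 = 2 · 120`). [cite: ConderDobcsanyi2001, entry R4.2 (|Aut| = 240)] -/
theorem pentagonMap_reflexible :
    ∃ ψ : Perm (Perm (Fin 5)), ψ * pentagonMap.rot = pentagonMap.rot⁻¹ * ψ ∧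
      ψ * pentagonMap.edgeInv = pentagonMap.edgeInv * ψ := by
  have hs : swap (0 : Fin 5) 2 * rotGen * swap 0 2 = rotGen⁻¹ := by decide
  have ht : swap (0 : Fin 5) 2 * invGen * swap 0 2 = invGen := by decide
  have hcc : ∀ x : Perm (Fin 5), swap (0 : Fin 5) 2 * (swap (0 : Fin 5) 2 * x) = x :=
    fun x => swap_mul_self_mul 0 2 x
  have hc1 : swap (0 : Fin 5) 2 * swap 0 2 = 1 := swap_mul_self 0 2
  let ψ : Perm (Perm (Fin 5)) :=
    ⟨fun g => swap 0 2 * g * swap 0 2, fun g => swap 0 2 * g * swap 0 2,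
      fun g => by simp [mul_assoc, hcc, hc1], fun g => by simp [mul_assoc, hcc, hc1]⟩
  have hψ : ∀ g, ψ g = swap 0 2 * g * swap 0 2 := fun g => rfl
  refine ⟨ψ, ?_, ?_⟩
  · refine Equiv.ext fun g => ?_
    simp only [pentagonMap, Fatgraph.ofGroup_rot, inv_mulRight, Perm.coe_mul, comp_apply,
      coe_mulRight, hψ]
    rw [← hs]
    simp only [mul_assoc, hcc]
  · refine Equiv.ext fun g => ?_
    simp only [pentagonMap, Fatgraph.ofGroup_edgeInv, Perm.coe_mul, comp_apply, coe_mulRight, hψ]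
    conv_rhs => rw [← ht]
    simp only [mul_assoc, hcc]

/-! ### The dual `{4,5}` map: 30 squares, five at each of 24 vertices (R4.2) -/

/-- **The regular map of type `{4,5}` on Bring's surface** (R4.2 of the census; the square
complex with 30 squares and 24 vertices of degree 5), as `𝓜(S₅; ts, t)`.
[cite: ConderDobcsanyi2001, entry R4.2 (genus 4, type {4,5}_6)] -/
def squareMap : Fatgraph (Perm (Fin 5)) :=
  Fatgraph.ofGroup (invGen * rotGen) invGen invGen_mul_self invGen_ne_one

/-- It is the dual of the `{5,4}` map. [folklore] -/
theorem squareMap_eq_dual : squareMap = pentagonMap.dual := by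
  unfold squareMap pentagonMap
  exact (Fatgraph.ofGroup_dual rotGen invGen invGen_mul_self invGen_ne_one).symm

/-- Type `{4,5}`: every face is a square, every vertex has valency `5`.
[cite: ConderDobcsanyi2001, entry R4.2] -/
theorem squareMap_isOfMapType : squareMap.IsOfMapType 4 5 := by
  rw [squareMap_eq_dual]; exact pentagonMap_isOfMapType.dual

/-- `30` square faces. [cite: ConderDobcsanyi2001, entry R4.2] -/
theorem squareMap_numBoundary : squareMap.numBoundary = 30 := by
  rw [squareMap_eq_dual, Fatgraph.dual_numBoundary, pentagonMap_numVertices]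

/-- `24` vertices. [cite: ConderDobcsanyi2001, entry R4.2] -/
theorem squareMap_numVertices : squareMap.numVertices = 24 := by
  rw [squareMap_eq_dual, Fatgraph.dual_numVertices, pentagonMap_numBoundary]

/-- `60` edges. [folklore] -/
theorem squareMap_numEdges : squareMap.numEdges = 60 := by
  rw [squareMap_eq_dual, Fatgraph.dual_numEdges, pentagonMap_numEdges]

/-- The square map is connected. [folklore] -/
theorem squareMap_isConnected : squareMap.IsConnected := by
  unfold squareMap
  exact Fatgraph.ofGroup_isConnected _ _ _ _ closure_faceGen_invGen

/-- **Genus 4** for the square map: connected, `30` faces, `24 - 60 = 2 - 2·4 - 30`. [folklore] -/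
theorem squareMap_isOfType : squareMap.IsOfType 4 30 := by
  rw [Fatgraph.isOfType_iff_eulerChar, squareMap_eq_dual, Fatgraph.dual_eulerChar,
    pentagonMap_eulerChar, ← squareMap_eq_dual]
  exact ⟨squareMap_isConnected, squareMap_numBoundary, by norm_num⟩

/-- The square map is orientably regular, with the same automorphism group as its dual.
[folklore] -/
theorem squareMap_isOrientablyRegular_and_aut :
    squareMap.IsOrientablyRegular ∧
      squareMap.automorphismGroup = pentagonMap.automorphismGroup := by
  rw [squareMap_eq_dual, Fatgraph.dual_automorphismGroup]
  exact ⟨pentagonMap_isOrientablyRegular.dual, rfl⟩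

/-- **No loops**: the two darts of an edge lie at distinct vertices (`t ∉ ⟨ts⟩`). [folklore] -/
theorem squareMap_loopless (g : Perm (Fin 5)) :
    ¬ squareMap.rot.SameCycle g (squareMap.edgeInv g) := by
  unfold squareMap
  rw [Fatgraph.ofGroup_rot, Fatgraph.ofGroup_edgeInv, coe_mulRight, sameCycle_mulRight_iff,
    inv_mul_cancel_left]
  exact notMem_zpowers_faceGen (by decide)

/-- **No multiple edges**: two darts at the same vertex whose opposite darts are also at a common
vertex coincide — the 1-skeleton (24 vertices of degree 5, 60 edges) is a simple graph.
[folklore] -/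
theorem squareMap_simpleEdges (g h : Perm (Fin 5)) (hv : squareMap.rot.SameCycle g h)
    (hw : squareMap.rot.SameCycle (squareMap.edgeInv g) (squareMap.edgeInv h)) : g = h := by
  unfold squareMap at hv hw
  rw [Fatgraph.ofGroup_rot] at hv hw
  rw [Fatgraph.ofGroup_edgeInv, coe_mulRight, sameCycle_mulRight_iff] at hw
  rw [sameCycle_mulRight_iff, Subgroup.mem_zpowers_iff] at hv
  obtain ⟨k, hk⟩ := hv
  rw [← zpow_mod_orderOf, orderOf_invGen_mul_rotGen] at hk
  obtain ⟨n, hn⟩ := Int.eq_ofNat_of_zero_le (Int.emod_nonneg k (by norm_num : ((5 : ℕ) : ℤ) ≠ 0))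
  have hlt := Int.emod_lt_of_pos k (by norm_num : (0 : ℤ) < ((5 : ℕ) : ℤ))
  rw [hn, zpow_natCast] at hk
  -- `hk : (ts)^n = g⁻¹ h`, `n < 5`; the second condition says `t (ts)^n t ∈ ⟨ts⟩`
  have hw' : invGen * (invGen * rotGen) ^ n * invGen ∈ Subgroup.zpowers (invGen * rotGen) := by
    have e : (g * invGen)⁻¹ * (h * invGen) = invGen * (invGen * rotGen) ^ n * invGen := by
      rw [hk, mul_inv_rev, invGen, swap_inv]; simp only [mul_assoc]
    rwa [e] at hw
  have hn5 : n < 5 := by omega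
  suffices hn0 : n = 0 by
    rw [hn0, pow_zero] at hk
    exact inv_mul_eq_one.mp hk.symm
  by_contra hn0
  interval_cases n
  · exact hn0 rfl
  all_goals exact notMem_zpowers_faceGen (by decide) hw'

/-- **Every square has four distinct corners**: walking `i = 1, 2, 3` steps along a face boundary
never returns to the starting vertex (`sⁱ ∉ ⟨ts⟩`). [folklore] -/
theorem squareMap_face_corners_distinct (g : Perm (Fin 5)) (i : ℕ) (hi : i < 4) (hi₀ : i ≠ 0) :
    ¬ squareMap.rot.SameCycle g ((squareMap.face ^ i) g) := by
  unfold squareMap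
  rw [Fatgraph.ofGroup_rot, Fatgraph.ofGroup_face, ← mul_assoc, invGen_mul_self, one_mul,
    pow_mulRight, coe_mulRight, sameCycle_mulRight_iff, inv_mul_cancel_left]
  interval_cases i
  · exact absurd rfl hi₀
  all_goals exact notMem_zpowers_faceGen (by decide)

/-- **Summary (the fact as requested).** Bring's surface carries the regular map of type `{5,4}`
— 24 pentagons, 30 vertices of valency 4, 60 edges, genus 4 (`χ = 2 - 2·4`), orientably regular
with rotation group `≅ S₅` of order 120 — and its dual is the `{4,5}` square complex with 30
squares, 24 vertices of degree 5 and 60 edges on the same surface (census R4.2).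
[cite: Weber2005, §2 (p. 171) and Prop. 2.2; census entry R4.2 of ConderDobcsanyi2001] -/
theorem regularMaps_summary :
    pentagonMap.IsOfMapType 5 4 ∧ pentagonMap.numBoundary = 24 ∧ pentagonMap.numVertices = 30 ∧
      pentagonMap.numEdges = 60 ∧ pentagonMap.IsOfType 4 24 ∧ pentagonMap.IsOrientablyRegular ∧
      Nonempty (Perm (Fin 5) ≃* pentagonMap.automorphismGroup) ∧ pentagonMap.numAut = 120 ∧
      squareMap = pentagonMap.dual ∧ squareMap.IsOfMapType 4 5 ∧ squareMap.numBoundary = 30 ∧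
      squareMap.numVertices = 24 ∧ squareMap.numEdges = 60 ∧ squareMap.IsOfType 4 30 :=
  ⟨pentagonMap_isOfMapType, pentagonMap_numBoundary, pentagonMap_numVertices,
    pentagonMap_numEdges, pentagonMap_isOfType, pentagonMap_isOrientablyRegular,
    ⟨pentagonMapAutEquiv⟩, pentagonMap_numAut, squareMap_eq_dual, squareMap_isOfMapType,
    squareMap_numBoundary, squareMap_numVertices, squareMap_numEdges, squareMap_isOfType⟩

end Bring

end Literature.Geometry.Teichmuller

end
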